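import Literature.AnabelianGeometry.AbsoluteAnabelian.LocalResidueMapRestriction
import Literature.NumberTheory.GaloisRepresentations.LocalWeilDatumExtensionValuation
import HarnessLib

/-!
# The residue map under restriction to a finite extension, II: `inv_E ∘ Res = [E : F] · inv_F`

abc-iut cell, layer L4 (sub-DAG `plan/L4/SUBDAG-AbsTopIII-Prop32.md`, row **P32.i.L07-model**; seat
abc-iut-w5-d201).  J.-P. Serre, *Corps locaux* (1968) XIII §3 Prop. 7: for a finite extension `E/F` of
non-archimedean local fields, `inv_E ∘ Res_{E/F} = [E : F] · inv_F`; [AbsTopIII] Rmk. 3.2.2 p. 73 /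
Rmk. 1.10.1 (iii) p. 41 («compatibility relative to dividing the `Ẑ` … by a factor given by the index of the
image of the induced open homomorphism on arithmetic Galois groups») — the model instance of the
schema `Prop32i_indexCompat` (`MonoidKummerMapsSub.lean`) with map `:= Res`, index `:= [E : F]`.

For non-archimedean local fields `F`, `E` of characteristic `0` (valued form, each with its own structure)
and a finite `F`-algebra structure on `E`:

* **`Prop121vii.invLevel_resMu`** — `inv_{E,n} (Res x) = [E : F] · inv_{F,n} (x)` in `ℤ/n` for THE level
  residue maps `invLevel` (unique `IsInvariantMap`, abc-iut-w5-d198/d201/d214);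
* **`Prop121vii.invariantQZEquiv_res`** — `invariantQZEquiv E (Res x) = [E : F] • invariantQZEquiv F x`
  in `ℚ/ℤ` on `H²(·, μ_{ℚ/ℤ}) = colim_n H²(·, μ_n)`.

Proof (Serre's, at finite level): `H²(Γ_F, μ_n)` is generated by the canonical class `κ_n(π_F) ∪ χ_F`
(`inv_F = 1`); its restriction is `f · (κ_n(π_F)_E ∪ χ_E)` (`resMu_cupProduct_δ₀_scalarCocycle`,
`cyclicCharacter_absGaloisRestrict_eq`, part I); in `E`, `π_F = v · π_E ^ e` with `v` a unit
(`e = ramificationIdx'`, `f = inertiaDeg'` of `𝔓 ∩ E₀` for `E₀ = ι⁻¹(E) ⊆ F̄`, `e f = [E : F]`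
— `LocalWeilDatumValuation` / `LocalWeilDatumExtensionValuation`), the class `κ_n(v) ∪ χ_E` vanishes
(units are norms from the unramified extension, `exists_normalizedCharacter` + the cochain identity
`cohomologyMap_kummerι_cupProduct_δ₀_scalar` + `kummerTwoOntoTorsion_holds`), and `inv_E(κ_n(π_E) ∪ χ_E) = 1`,
whence `inv_E (Res c_F) = f · e = [E : F]`.  All multiplicities are carried inside the invariants
`(K̄ˣ)^{Γ_K}` (additivity only on cohomology).  Proof-only; no named fact; HONEST FRAMING: classical,
nothing here bears on [IUTchIII] Cor. 3.12 or takes a side.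
-/

noncomputable section

universe u

namespace Literature.AnabelianGeometry.AbsoluteAnabelian

open Field Function IntermediateField CategoryTheory
open Literature.NumberTheory.GaloisRepresentations
open Literature.NumberTheory.GaloisRepresentations.DiscreteGaloisModule
open Literature.NumberTheory.GaloisRepresentations.LocalWeilDatum
open Literature.NumberTheory.GaloisRepresentations.IsNonarchimedeanLocalField
open ValuativeRel

namespace Prop121vii

/-! ### The index formula at level `n`: `inv_E ∘ Res = [E : F] · inv_F` -/

section Level

variable (F E : Type u) [Field F] [ValuativeRel F] [TopologicalSpace F] [IsNonarchimedeanLocalField F]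
  [CharZero F] [Field E] [ValuativeRel E] [TopologicalSpace E] [IsNonarchimedeanLocalField E]
  [CharZero E] [Algebra F E] [FiniteDimensional F E]

omit [ValuativeRel F] [TopologicalSpace F] [IsNonarchimedeanLocalField F] [CharZero F]
  [ValuativeRel E] [TopologicalSpace E] [IsNonarchimedeanLocalField E] [CharZero E]
  [Algebra F E] [FiniteDimensional F E] in
/-- `baseUnitsInvariant` only depends on the element. [cite: SerreGaloisCohomology1997, II §1.2] -/
private theorem baseUnitsInvariant_congr (K : Type u) [Field K] {x y : K} (hx : x ≠ 0) (hy : y ≠ 0)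
    (h : x = y) : baseUnitsInvariant K x hx = baseUnitsInvariant K y hy := by
  subst h
  rfl

set_option maxHeartbeats 400000 in
/-- **The residue maps under restriction, level `n`: `inv_{E,n}(Res x) = [E : F] · inv_{F,n}(x)`** for a
finite extension `E/F` of MLFs (char. `0`) and THE residue maps `invLevel` (`IsInvariantMap`,
abc-iut-w5-d198/d201). Serre, *Corps locaux* XIII §3 Prop. 7 (`inv_E ∘ Res_{E/F} = [E : F] · inv_F`);
[AbsTopIII] Rmk. 3.2.2 «dividing … by a factor given by the index». Proof: `H²(Γ_F, μ_n)` is generated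
by the canonical class `κ_n(π_F) ∪ χ_F` (`inv_F = 1` there); its restriction is
`f · (κ_n(π_F)_E ∪ χ_E)` (`resMu_cupProduct_δ₀_scalarCocycle`, `cyclicCharacter_absGaloisRestrict_eq`),
and in `E`, `π_F = v · π_E^e` with `v` a unit, whose class `κ_n(v) ∪ χ_E` vanishes (units are norms
from the unramified extension), so `inv_E` gives `f · e = [E : F]`.
[cite: SerreLocalFields1979, XIII §3 Prop. 7] -/
theorem invLevel_resMu (n : ℕ) [NeZero n] (x : galoisCohomology (mu F n) 2) :
    invLevel E n (resMu F E n 2 x) = (Module.finrank F E : ZMod n) * invLevel F n x := by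
  classical
  haveI : CompactSpace (absoluteGaloisGroup F) := absoluteGaloisGroup_compactSpace F
  haveI : CompactSpace (absoluteGaloisGroup E) := absoluteGaloisGroup_compactSpace E
  rcases Nat.lt_or_ge 1 n with hn1 | hn1
  swap
  · -- `n = 1`: `ℤ/1` is trivial
    have hn : n = 1 := le_antisymm hn1 (NeZero.pos n)
    subst hn
    exact Subsingleton.elim _ _
  /- ramification index and residue degree of `E/F` -/
  haveI : ValuativeExtension F E :=
    valuativeExtension_of_cast_residueFieldCard_eq_zero cast_residueFieldCard_eq_zero_of_algebra
  haveI := finiteDimensional_embField F E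
  have hKs : embField F E ≤ sepClosure F := embField_le_sepClosure F E
  set f := Ideal.inertiaDeg' 𝓂[F] (primeOf F (embField F E)) with hfdef
  set e := Ideal.ramificationIdx' 𝓂[F] (primeOf F (embField F E)) with hedef
  have hf : residueFieldCard E = residueFieldCard F ^ f := residueFieldCard_eq_pow_inertiaDeg F E
  have hef : e * f = Module.finrank F E :=
    (ramificationIdx_mul_inertiaDeg F (embField F E) hKs).trans
      (equivEmbField F E).toLinearEquiv.finrank_eq.symm
  /- a uniformiser `π_F` of `F` and its factorisation `π_F = v · π_E ^ e` in `E` -/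
  obtain ⟨ϖF, hϖF⟩ := IsDiscreteValuationRing.exists_irreducible 𝒪[F]
  have hπF0 : (ϖF : F) ≠ 0 := fun h => hϖF.ne_zero (Subtype.ext h)
  have hπF : (valuation F).IsUniformizer (ϖF : F) := (ord_eq_one_iff F hπF0).1 (ord_eq_one_of_irreducible F hϖF)
  have hπF0' : algebraMap F E (ϖF : F) ≠ 0 := (map_ne_zero_iff _ (algebraMap F E).injective).2 hπF0
  obtain ⟨ϖE, hϖE⟩ := IsDiscreteValuationRing.exists_irreducible 𝒪[E]
  have hπE0 : (ϖE : E) ≠ 0 := fun h => hϖE.ne_zero (Subtype.ext h)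
  have hπE : (valuation E).IsUniformizer (ϖE : E) := (ord_eq_one_iff E hπE0).1 (ord_eq_one_of_irreducible E hϖE)
  -- `ord_E (π_F) = e`, read in the integral closure of `𝒪[F]` in `E₀ = ι⁻¹(E)`
  haveI := isDiscreteValuationRing_integralClosure' F (embField F E) hKs
  obtain ⟨πO, hπO⟩ := IsDiscreteValuationRing.exists_irreducible (integralClosure 𝒪[F] (embField F E))
  have hcoe : (((algebraMap 𝒪[F] (integralClosure 𝒪[F] (embField F E)) ϖF :
      integralClosure 𝒪[F] (embField F E)) : embField F E) : AlgebraicClosure F) =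
      algebraMap F (AlgebraicClosure F) (ϖF : F) := rfl
  have ha0 : algebraMap 𝒪[F] (integralClosure 𝒪[F] (embField F E)) ϖF ≠ 0 := by
    intro h
    apply hπF0
    have h' := congrArg (fun a : integralClosure 𝒪[F] (embField F E) => ((a : embField F E) : AlgebraicClosure F)) h
    simp only [hcoe] at h'
    exact (map_eq_zero_iff _ (algebraMap F (AlgebraicClosure F)).injective).1 h'
  obtain ⟨k, u, hk⟩ := IsDiscreteValuationRing.eq_unit_mul_pow_irreducible ha0 hπO
  have hek : e = k := ramificationIdx_eq_of_eq_unit_mul_pow F (embField F E) hKs hϖF hπO hk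
  have hsymm : (equivEmbField F E).symm
      ((algebraMap 𝒪[F] (integralClosure 𝒪[F] (embField F E)) ϖF : integralClosure 𝒪[F] (embField F E)) :
        embField F E) = algebraMap F E (ϖF : F) := by
    have h1 : ((algebraMap 𝒪[F] (integralClosure 𝒪[F] (embField F E)) ϖF :
        integralClosure 𝒪[F] (embField F E)) : embField F E) = algebraMap F (embField F E) (ϖF : F) :=
      Subtype.ext hcoe
    rw [h1, AlgEquiv.commutes]
  have hordπ : ord E (algebraMap F E (ϖF : F)) = (e : ℤ) := by
    rw [← hsymm, ord_symm_eq_of_eq_unit_mul_pow F E hπO hk, hek]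
  set v : E := algebraMap F E (ϖF : F) / (ϖE : E) ^ e with hvdef
  have hv0 : v ≠ 0 := div_ne_zero hπF0' (pow_ne_zero _ hπE0)
  have hv1 : valuation E v = 1 := by
    rw [← ord_eq_zero_iff E hv0, hvdef, ord_div E hπF0' (pow_ne_zero _ hπE0), ord_pow E hπE0, hordπ,
      ord_eq_one_of_irreducible E hϖE]
    ring
  have hvπ : v * (ϖE : E) ^ e = algebraMap F E (ϖF : F) := div_mul_cancel₀ _ (pow_ne_zero _ hπE0)
  /- the normalised characters and the canonical classes -/
  obtain ⟨ψF, hIF, hFF, -, -⟩ := exists_normalizedCharacter F n hn1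
  obtain ⟨ψE, hIE, hFE, -, hunitE⟩ := exists_normalizedCharacter E n hn1
  have hgF : IsNormalizedUnramifiedCocycle F n (scalarCocycle ψF) :=
    isNormalizedUnramifiedCocycle_scalarCocycle F ψF hIF hFF
  have hgE : IsNormalizedUnramifiedCocycle E n (scalarCocycle ψE) :=
    isNormalizedUnramifiedCocycle_scalarCocycle E ψE hIE hFE
  have hψ : ∀ σ : absoluteGaloisGroup E, ψF (absGaloisRestrict F E σ) = (f : ZMod n) * ψE σ :=
    cyclicCharacter_absGaloisRestrict_eq F E ψF ψE hIF hFF hIE hFE hf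
  -- the base invariants
  set uF := baseUnitsInvariant F (ϖF : F) hπF0 with huF
  set uE := baseUnitsInvariant E (algebraMap F E (ϖF : F)) hπF0' with huE
  set uv := baseUnitsInvariant E v hv0 with huv
  set uπ := baseUnitsInvariant E (ϖE : E) hπE0 with huπ
  have huE' : uE = uv + (e : ℤ) • uπ := by
    rw [huE, huv, huπ, ← baseUnitsInvariant_pow, ← baseUnitsInvariant_mul]
    exact baseUnitsInvariant_congr E _ _ hvπ.symm
  /- carrier-typed aliases (all additive bookkeeping happens on Mathlib's carriers) -/
  let ιF : continuousCohomology 2 (mu F n).toTopRep →+ ZMod n := invLevel F n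
  let ιE : continuousCohomology 2 (mu E n).toTopRep →+ ZMod n := invLevel E n
  let r : continuousCohomology 2 (mu F n).toTopRep →+ continuousCohomology 2 (mu E n).toTopRep :=
    resMu F E n 2
  let PF := (mu F n).tateDualPairing n
  let PE := (mu E n).tateDualPairing n
  let gF := oneCocycleClass ((mu F n).tateDual n).toTopRep (scalarCocycle ψF)
  let gE := oneCocycleClass ((mu E n).tateDual n).toTopRep (scalarCocycle ψE)
  let δF := (isSES_kummer F n (NeZero.pos n)).δ₀
  let δE := (isSES_kummer E n (NeZero.pos n)).δ₀
  have haddF : ∀ a b : continuousCohomology 1 (mu F n).toTopRep,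
      PF.cupProduct (a + b) gF = PF.cupProduct a gF + PF.cupProduct b gF := fun a b => by
    rw [map_add, LinearMap.add_apply]
  have haddE : ∀ a b : continuousCohomology 1 (mu E n).toTopRep,
      PE.cupProduct (a + b) gE = PE.cupProduct a gE + PE.cupProduct b gE := fun a b => by
    rw [map_add, LinearMap.add_apply]
  have hsuccF : ∀ (m : ℕ) (w : (units F).toTopRep.ρ.invariants),
      (((m + 1 : ℕ) : ℤ)) • w = ((m : ℤ)) • w + w := fun m w => by
    rw [Nat.cast_succ, add_smul, one_smul]
  have hsuccE : ∀ (m : ℕ) (w : (units E).toTopRep.ρ.invariants),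
      (((m + 1 : ℕ) : ℤ)) • w = ((m : ℤ)) • w + w := fun m w => by
    rw [Nat.cast_succ, add_smul, one_smul]
  -- the canonical class of `F` has invariant `1`
  have h1F : ιF (PF.cupProduct (δF uF) gF) = 1 :=
    (isInvariantMap_invLevel F n).2 (scalarCocycle ψF) hgF (ϖF : F) hπF uF
      (coe_unitsVal_baseUnitsInvariant F _ hπF0)
  -- restriction of the canonical class
  have hres : r (PF.cupProduct (δF uF) gF) = PE.cupProduct (δE ((f : ℤ) • uE)) gE :=
    resMu_cupProduct_δ₀_scalarCocycle F E ψF ψE hψ (ϖF : F) hπF0 hπF0'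
  -- in `E`: the unit part vanishes, the uniformiser part has invariant `1`
  have hunit : PE.cupProduct (δE uv) gE = 0 := by
    have h := cohomologyMap_kummerι_cupProduct_δ₀_scalar ψE (scalarCocycle ψE) (scalarCocycle_apply ψE) uv
    rw [hunitE v hv0 hv1 uv (coe_unitsVal_baseUnitsInvariant E v hv0), neg_zero] at h
    exact (kummerTwoOntoTorsion_holds E n).1 (h.trans (map_zero _).symm)
  have hone : ιE (PE.cupProduct (δE uπ) gE) = 1 :=
    (isInvariantMap_invLevel E n).2 (scalarCocycle ψE) hgE (ϖE : E) hπE uπ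
      (coe_unitsVal_baseUnitsInvariant E _ hπE0)
  have hunit' : ∀ m : ℕ, PE.cupProduct (δE (((m : ℤ)) • uv)) gE = 0 := by
    intro m
    induction m with
    | zero => rw [Nat.cast_zero, zero_smul, map_zero δE, map_zero PE.cupProduct, LinearMap.zero_apply]
    | succ m ih => rw [hsuccE, map_add δE, haddE, ih, hunit, add_zero]
  have hone' : ∀ m : ℕ, ιE (PE.cupProduct (δE (((m : ℤ)) • uπ)) gE) = (m : ZMod n) := by
    intro m
    induction m with
    | zero =>
      rw [Nat.cast_zero, zero_smul, map_zero δE, map_zero PE.cupProduct, LinearMap.zero_apply, map_zero ιE,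
        Nat.cast_zero]
    | succ m ih => rw [hsuccE, map_add δE, haddE, map_add ιE, ih, hone, Nat.cast_succ]
  have hinvres : ιE (r (PF.cupProduct (δF uF) gF)) = (Module.finrank F E : ZMod n) := by
    rw [hres, huE', smul_add, smul_smul, ← Nat.cast_mul, map_add δE, haddE, map_add ιE, hunit', hone',
      map_zero ιE, zero_add, ← hef, mul_comm e f]
  -- all multiples of the canonical class
  have key : ∀ m : ℕ, ιF (PF.cupProduct (δF (((m : ℤ)) • uF)) gF) = (m : ZMod n) ∧
      ιE (r (PF.cupProduct (δF (((m : ℤ)) • uF)) gF)) = (m : ZMod n) * (Module.finrank F E : ZMod n) := by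
    intro m
    induction m with
    | zero =>
      rw [Nat.cast_zero, zero_smul, map_zero δF, map_zero PF.cupProduct, LinearMap.zero_apply, map_zero ιF,
        map_zero r, map_zero ιE, Nat.cast_zero, zero_mul]
      exact ⟨rfl, rfl⟩
    | succ m ih =>
      obtain ⟨ih₁, ih₂⟩ := ih
      rw [hsuccF, map_add δF, haddF, map_add ιF, ih₁, h1F, map_add r, map_add ιE, ih₂, hinvres,
        Nat.cast_succ, add_mul, one_mul]
      exact ⟨rfl, rfl⟩
  -- `x` is a multiple of the canonical class (`inv_F` is injective)
  obtain ⟨hm₁, hm₂⟩ := key (ιF x).val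
  have hxc : x = PF.cupProduct (δF ((((ιF x).val : ℕ) : ℤ) • uF)) gF :=
    (isInvariantMap_invLevel F n).1.1 (by
      change ιF x = ιF _
      rw [hm₁, ZMod.natCast_zmod_val])
  change ιE (r x) = (Module.finrank F E : ZMod n) * ιF x
  rw [hxc, hm₂, hm₁, mul_comm]

end Level

/-! ### The index formula on `H²(·, μ_{ℚ/ℤ})` -/

section Colimit

variable (F E : Type u) [Field F] [Field E] [Algebra F E]
variable [ValuativeRel F] [TopologicalSpace F] [IsNonarchimedeanLocalField F] [CharZero F]
  [ValuativeRel E] [TopologicalSpace E] [IsNonarchimedeanLocalField E] [CharZero E] [FiniteDimensional F E]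

/-- **`inv_E ∘ Res = [E : F] · inv_F` on `H²(·, μ_{ℚ/ℤ})`** (Serre, *Corps locaux* XIII §3 Prop. 7;
[AbsTopIII] Rmk. 3.2.2 / Rmk. 1.10.1 (iii): the functoriality of `H²(G, μ) ⥲ ℚ/ℤ` «in the sense of a
compatibility relative to dividing … by the index»), for THE residue isomorphisms `invariantQZEquiv`
(abc-iut-w5-d214, `LocalResidueMapQmodZ.lean`). [cite: SerreLocalFields1979, XIII §3 Prop. 7]
[cite: MochizukiAbsTopIII2015, Remark 3.2.2 p.73] -/
theorem invariantQZEquiv_res (x : H2MuQZ F) :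
    invariantQZEquiv E (H2MuQZ.res F E x) = Module.finrank F E • invariantQZEquiv F x := by
  obtain ⟨n, x, rfl⟩ := H2MuQZ.exists_of x
  change invariantQZ E (H2MuQZ.res F E (H2MuQZ.of n x)) = Module.finrank F E • invariantQZ F (H2MuQZ.of n x)
  rw [H2MuQZ.res_of, invariantQZ_of', invariantQZ_of', invLevel_resMu, ← nsmul_eq_mul, map_nsmul]

end Colimit
end Prop121vii

end Literature.AnabelianGeometry.AbsoluteAnabelian

end
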